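import Mathlib
import HarnessLib
import Summits.ValiantsHypothesis.ValiantsHypothesis.Theorems.MonotoneRestorationOrbitRestorationQPSplit
import Summits.ValiantsHypothesis.ValiantsHypothesis.Theorems.MonotoneRestorationOrbitRestorationQPCloseOrbit

/-!
# Route MonotoneRestoration — crux `OrbitRestorationQP` (stmt-ValiantsHypothesis-18293):
# the crux from NARROW EXPRESSIONS (the expression form of K1)

With K3 (`stub_close_orbit`: the closed polynomial of a labelled pattern expression with `k + l` labels
has square-symmetric circuits of orbit size `≤ (n+1)^(k+l+2)`, WHATEVER ITS LENGTH) the crux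
`OrbitRestorationQP` follows from the EXPRESSION form of the narrow-expansion statement K1:

  K1ᵉ: every matrix-symmetric `VP` family `f` is, for one constant `c` and every `n ≥ 1`, the closed
  polynomial of SOME labelled pattern expression (`PatternExpr ℂ`, the bipartite graph algebra of
  `Literature/Computability/AlgebraicComplexity/PatternExpressions.lean`) with `(log₂ n + c)^c` row and
  `(log₂ n + c)^c` column labels — of any length.

K1 (`NarrowExpansionVP`, hom-expansion in patterns of treewidth `≤ (log₂ n + c)^c`) implies K1ᵉ by K2
(`stub_homPoly_close`, `Theorems/…HomPolyClose.lean`) and linearity of `close`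
(`narrowExpansion_exists_expr`), so K1ᵉ is formally the WEAKER sufficient condition, and it is the
compositional one: closed expressions are closed under sums, scalars and — for fully summed-out
expressions, up to the normalising constants `n^{-(k+l)}` — products without spending labels, and they
contain the route's ζ-pattern rung (`qpSymmetric_patternExpr`) natively.  (The converse "closed
`(k,l)`-expressions lie in the span of patterns of treewidth `≤ k + l − 1`" — Lovász §6.5 — would make
K1 and K1ᵉ equivalent up to `c ↦ 2c`; it is not needed here and not formalised.)

* `qpOrbit_of_close_eq` — family by family, no `VP`, no symmetry: `f n = e.close n` with
  `(log₂ n + c)^c` labels a side ⇒ a square-symmetric circuit of orbit `≤ 2^((log₂ n + c + 3)^(c+3))`;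
* **`orbitRestorationQP_of_narrowExpressions`**: K1ᵉ → `OrbitRestorationQP`.

VP ≠ VNP is not moved (K1ᵉ, like K1, is conjecture-grade: an arithmetic CFI family in characteristic 0
would refute it, DawarWilsenach2025 §8).
-/

noncomputable section

-- `Summit.ValiantsHypothesis.ValiantsHypothesis.…` is the tree's single-conjunct layout (Sub = Summit).
set_option linter.dupNamespace false

namespace Summit.ValiantsHypothesis.ValiantsHypothesis.Theorems.OrbitRestorationQPHomPolyClose

open Literature.Computability.AlgebraicComplexity

/-- **A narrow closed expression gives a quasi-polynomial orbit** (no `VP`, no symmetry hypothesis):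
if `p = e.close n` for a labelled pattern expression `e` with `(log₂ n + c)^c` row and column labels,
then `p` has a square-symmetric labelled circuit over `ℂ` of orbit size `≤ 2^((log₂ n + c + 3)^(c+3))`
(K3 and `(n+1)^(2W+2) ≤ 2^((log₂ n + c + 3)^(c+3))`). [folklore] -/
theorem qpOrbit_of_close_eq (n c : ℕ) (p : MvPolynomial (Fin n × Fin n) ℂ)
    (e : PatternExpr ℂ ((Nat.log 2 n + c) ^ c) ((Nat.log 2 n + c) ^ c)) (he : e.close n = p) :
    ∃ (G : Type) (_ : Fintype G) (C : LabelledArithCircuit ℂ (Fin n × Fin n) Unit G),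
      C.IsSymmetric (Equiv.Perm (Fin n)) ∧ C.eval (C.output ()) = p ∧
        C.orbitSize (Equiv.Perm (Fin n)) ≤ 2 ^ ((Nat.log 2 n + (c + 3)) ^ (c + 3)) := by
  obtain ⟨G, inst, C, hC, hev, horb⟩ := stub_close_orbit n _ _ e
  refine ⟨G, inst, C, hC, by rw [hev, he], horb.trans (le_trans ?_ (narrowExpansion_orbit_bound n c))⟩
  exact Nat.pow_le_pow_right (Nat.succ_pos n) (by omega)

/-- **The crux from narrow expressions (K1ᵉ → `OrbitRestorationQP`).** If every matrix-symmetric `VP`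
family over `ℂ` is, for one constant `c` and every `n ≥ 1`, the closed polynomial of a labelled pattern
expression with `(log₂ n + c)^c` row and `(log₂ n + c)^c` column labels (any length), then
`OrbitRestorationQP` holds (with constant `c + 3`; at `n = 0` every family is a constant, and for
`n = 0` a closed expression with labels is `0` — an empty sum — whence `n ≥ 1`). [folklore] -/
theorem orbitRestorationQP_of_narrowExpressions :
    (∀ f : (n : ℕ) → MvPolynomial (Fin n × Fin n) ℂ,
      (∀ (n : ℕ) (σ τ : Equiv.Perm (Fin n)),
        MvPolynomial.rename (fun p : Fin n × Fin n => (σ p.1, τ p.2)) (f n) = f n) →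
      IsVPFamily f →
      ∃ c : ℕ, ∀ n : ℕ, 1 ≤ n → ∃ e : PatternExpr ℂ ((Nat.log 2 n + c) ^ c) ((Nat.log 2 n + c) ^ c),
        e.close n = f n) →
    Summit.ValiantsHypothesis.ValiantsHypothesis.Theses.MonotoneRestoration.OrbitRestorationQP := by
  intro h f hsym hVP
  obtain ⟨c, hc⟩ := h f hsym hVP
  refine ⟨c + 3, fun n => ?_⟩
  rcases Nat.eq_zero_or_pos n with rfl | hn
  · -- `n = 0`: no variables, `f 0` is the constant `coeff 0 (f 0)` (a constant gate, orbit `1`)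
    obtain ⟨G, inst, C, hC, hev, horb⟩ :=
      stub_close_orbit 0 0 0 (PatternExpr.const (MvPolynomial.coeff 0 (f 0)))
    refine ⟨G, inst, C, hC, ?_, horb.trans (le_trans (by norm_num) Nat.one_le_two_pow)⟩
    rw [hev, narrowExpansion_close_const]
    exact (MvPolynomial.eq_C_of_isEmpty (f 0)).symm
  · obtain ⟨e, he⟩ := hc n hn
    exact qpOrbit_of_close_eq n c (f n) e he

/-- **K1 ⇒ K1ᵉ** (so the expression form is formally the weaker sufficient condition): a narrow
hom-expansion of `f n` (patterns of treewidth `≤ (log₂ n + c)^c`) is, for `n ≥ 1`, ONE closed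
expression with `(log₂ n + c)^c + 1` labels a side (K2 `stub_homPoly_close` and linearity of `close`,
`narrowExpansion_exists_expr`); stated with the shifted constant so that the label budget
`(log₂ n + (c+2))^(c+2)` covers `(log₂ n + c)^c + 1`. [folklore] -/
theorem narrowExpression_of_mem_narrowSpan
    (hK2 : ∀ (a b w : ℕ) (E : Multiset (Fin a × Fin b)),
      Literature.Combinatorics.SimpleGraph.treewidth
          (SimpleGraph.fromRel fun u v : Fin a ⊕ Fin b =>
            ∃ e ∈ E, u = Sum.inl e.1 ∧ v = Sum.inr e.2) ≤ w →
      ∀ n : ℕ, 1 ≤ n → ∀ k l : ℕ, w + 1 ≤ k → w + 1 ≤ l →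
        ∃ e : PatternExpr ℂ k l, e.close n = homPoly E n ℂ)
    (n c : ℕ) (hn : 1 ≤ n) (p : MvPolynomial (Fin n × Fin n) ℂ)
    (hp : p ∈ Submodule.span ℂ
        {p : MvPolynomial (Fin n × Fin n) ℂ | ∃ (a b : ℕ) (E : Multiset (Fin a × Fin b)),
          Literature.Combinatorics.SimpleGraph.treewidth
              (SimpleGraph.fromRel fun u v : Fin a ⊕ Fin b =>
                ∃ e ∈ E, u = Sum.inl e.1 ∧ v = Sum.inr e.2) ≤ (Nat.log 2 n + c) ^ c ∧
            p = homPoly E n ℂ}) :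
    ∃ e : PatternExpr ℂ ((Nat.log 2 n + (c + 2)) ^ (c + 2)) ((Nat.log 2 n + (c + 2)) ^ (c + 2)),
      e.close n = p := by
  -- the label budget: `(L+c)^c + 1 ≤ 2 (L+c)^c ≤ (L+c+2)^c · (L+c+2)^2`
  have hW : (Nat.log 2 n + c) ^ c + 1 ≤ (Nat.log 2 n + (c + 2)) ^ (c + 2) := by
    have h1 : (Nat.log 2 n + c) ^ c ≤ (Nat.log 2 n + (c + 2)) ^ c :=
      Nat.pow_le_pow_left (by omega) c
    have h2 : 1 ≤ (Nat.log 2 n + c) ^ c := by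
      rcases Nat.eq_zero_or_pos c with rfl | hc
      · simp
      · exact Nat.one_le_pow _ _ (by omega)
    have h3 : 4 ≤ (Nat.log 2 n + (c + 2)) ^ 2 := by
      have h4 : 2 ≤ Nat.log 2 n + (c + 2) := by omega
      calc 4 = 2 ^ 2 := rfl
        _ ≤ (Nat.log 2 n + (c + 2)) ^ 2 := Nat.pow_le_pow_left h4 2
    calc (Nat.log 2 n + c) ^ c + 1 ≤ (Nat.log 2 n + (c + 2)) ^ c * 4 := by omega
      _ ≤ (Nat.log 2 n + (c + 2)) ^ c * (Nat.log 2 n + (c + 2)) ^ 2 := Nat.mul_le_mul_left _ h3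
      _ = (Nat.log 2 n + (c + 2)) ^ (c + 2) := (pow_add _ _ _).symm
  induction hp using Submodule.span_induction with
  | mem q hq =>
    obtain ⟨a, b, E, htw, rfl⟩ := hq
    exact hK2 a b _ E htw n hn _ _ hW hW
  | zero => exact ⟨PatternExpr.const 0, narrowExpansion_close_zero n _ _⟩
  | add q q' _ _ hq hq' =>
    obtain ⟨e₁, he₁⟩ := hq
    obtain ⟨e₂, he₂⟩ := hq'
    exact ⟨PatternExpr.add e₁ e₂, by rw [narrowExpansion_close_add, he₁, he₂]⟩
  | smul r q _ hq =>
    obtain ⟨e, he⟩ := hq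
    exact ⟨PatternExpr.mul (PatternExpr.const r) e, by rw [narrowExpansion_close_smul, he]⟩

end Summit.ValiantsHypothesis.ValiantsHypothesis.Theorems.OrbitRestorationQPHomPolyClose

end
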